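import Mathlib.Topology.Algebra.ContinuousMonoidHom
import Mathlib.Algebra.Group.Subgroup.Map
import Literature.AnabelianGeometry.SemiGraphs.ArithMaximalCompact
import HarnessLib

/-!
# Semi-graphs of anabelioids, §3: Definition 3.8 (quasi-geometric homomorphisms), Remark 3.8.1

Mochizuki, *Semi-graphs of anabelioids*, Publ. RIMS **42** (2006), §3, manuscript p. 42
[cite: MochizukiSemiAnbd2006, Def 3.8 p.42]: maximal compact subgroups of a topological group
(`IsMaximalCompactSubgroup`, the notion of Thm. 3.7 (iv)), quasi-geometric continuous homomorphisms
of tempered groups (`IsQuasiGeometric`; "maps surjectively onto an open subgroup of" is the §5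
file's `MapsOntoOpenSubgroupOf`), and Remark 3.8.1 "any isomorphism of temperoids is
quasi-geometric" PROVED for the underlying isomorphism of topological groups
(`IsQuasiGeometric.of_continuousMulEquiv`; isomorphisms of connected temperoids correspond to such by
Prop. 3.2). The temperoid-level phrase "a quasi-geometric morphism of temperoids is a morphism each
of whose component morphisms arises from a quasi-geometric continuous homomorphism" is recorded here,
not typed (it needs the component morphisms of Remark 3.1.4). No statement of the paper is
strengthened.
-/

open Topology

namespace Literature.AnabelianGeometry.SemiGraphs

universe u

/-! ### Definition 3.8: quasi-geometric homomorphisms (p. 42) -/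

section QuasiGeometric

variable {G₁ : Type u} [Group G₁] [TopologicalSpace G₁] {G₂ : Type u} [Group G₂] [TopologicalSpace G₂]

/-- A *maximal compact subgroup*: a subgroup that is compact and not properly contained in a
compact subgroup — the notion used in [SemiAnbd] Thm. 3.7 (iv) and Def. 3.8, pp. 41–42 ("the
maximal compact subgroups of `π₁^temp(G)` are precisely the verticial subgroups").
[cite: MochizukiSemiAnbd2006, Thm 3.7(iv) p.41] -/
def IsMaximalCompactSubgroup (K : Subgroup G₁) : Prop :=
  IsCompact (K : Set G₁) ∧ ∀ K' : Subgroup G₁, IsCompact (K' : Set G₁) → K ≤ K' → K' = K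

/-- **Definition 3.8** ([SemiAnbd] §3 p. 42): a continuous homomorphism of tempered groups
`Π₁ → Π₂` is *quasi-geometric* if "any maximal compact subgroup `K₁ ⊆ Π₁` (respectively,
nontrivial intersection `K₁ ∩ H₁` of two distinct maximal compact subgroups `K₁, H₁ ⊆ Π₁`) maps
surjectively to an open subgroup of some maximal compact subgroup `K₂ ⊆ Π₂` (respectively, of some
nontrivial intersection `K₂ ∩ H₂` of two distinct maximal compact subgroups `K₂, H₂ ⊆ Π₂`)" —
"maps surjectively to an open subgroup of" being the tree's `MapsOntoOpenSubgroupOf` ([SemiAnbd] §5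
file). [cite: MochizukiSemiAnbd2006, Def 3.8 p.42] -/
@[mk_iff] structure IsQuasiGeometric (φ : G₁ →ₜ* G₂) : Prop where
  /-- maximal compact subgroups go onto open subgroups of maximal compact subgroups -/
  maximal : ∀ K₁ : Subgroup G₁, IsMaximalCompactSubgroup K₁ →
    ∃ K₂ : Subgroup G₂, IsMaximalCompactSubgroup K₂ ∧ MapsOntoOpenSubgroupOf φ.toMonoidHom K₁ K₂
  /-- nontrivial intersections of two distinct maximal compact subgroups likewise -/
  inter : ∀ K₁ H₁ : Subgroup G₁, IsMaximalCompactSubgroup K₁ → IsMaximalCompactSubgroup H₁ →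
    K₁ ≠ H₁ → K₁ ⊓ H₁ ≠ ⊥ →
    ∃ K₂ H₂ : Subgroup G₂, IsMaximalCompactSubgroup K₂ ∧ IsMaximalCompactSubgroup H₂ ∧
      K₂ ≠ H₂ ∧ K₂ ⊓ H₂ ≠ ⊥ ∧ MapsOntoOpenSubgroupOf φ.toMonoidHom (K₁ ⊓ H₁) (K₂ ⊓ H₂)

/-- Transport of a subgroup along an isomorphism of topological groups preserves compactness.
[folklore] -/
private theorem isCompact_map_iff (e : G₁ ≃ₜ* G₂) (K : Subgroup G₁) :
    IsCompact ((K.map e.toMonoidHom : Subgroup G₂) : Set G₂) ↔ IsCompact (K : Set G₁) := by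
  have : ((K.map e.toMonoidHom : Subgroup G₂) : Set G₂) = e.toHomeomorph '' (K : Set G₁) := by
    ext; simp
  rw [this]
  exact e.toHomeomorph.isCompact_image

/-- An isomorphism of topological groups carries maximal compact subgroups to maximal compact
subgroups. [folklore] -/
private theorem isMaximalCompactSubgroup_map (e : G₁ ≃ₜ* G₂) {K : Subgroup G₁}
    (hK : IsMaximalCompactSubgroup K) : IsMaximalCompactSubgroup (K.map e.toMonoidHom) := by
  refine ⟨(isCompact_map_iff e K).mpr hK.1, fun K' hK' hle => ?_⟩
  -- pull `K'` back along `e`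
  have hK'c : IsCompact ((K'.map e.symm.toMonoidHom : Subgroup G₁) : Set G₁) :=
    (isCompact_map_iff e.symm K').mpr hK'
  have hle' : K ≤ K'.map e.symm.toMonoidHom := by
    intro x hx
    exact ⟨e x, hle ⟨x, hx, rfl⟩, e.symm_apply_apply x⟩
  have heq := hK.2 _ hK'c hle'
  -- push forward again
  apply le_antisymm _ hle
  intro y hy
  have : e.symm y ∈ K := by rw [← heq]; exact ⟨y, hy, rfl⟩
  exact ⟨e.symm y, this, e.apply_symm_apply y⟩

/-- **Remark 3.8.1** ([SemiAnbd] §3 p. 42): "It is immediate that any isomorphism of temperoids is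
quasi-geometric" — here for the underlying isomorphism of topological groups (to which an
isomorphism of connected temperoids corresponds by Proposition 3.2).
[cite: MochizukiSemiAnbd2006, Rmk 3.8.1 p.42] -/
theorem IsQuasiGeometric.of_continuousMulEquiv (e : G₁ ≃ₜ* G₂) :
    IsQuasiGeometric (e : G₁ →ₜ* G₂) := by
  have hmap : ∀ H : Subgroup G₁, H.map (e : G₁ →ₜ* G₂).toMonoidHom = H.map e.toMonoidHom :=
    fun H => rfl
  have hopen : ∀ H : Subgroup G₁,
      MapsOntoOpenSubgroupOf (e : G₁ →ₜ* G₂).toMonoidHom H (H.map e.toMonoidHom) := by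
    intro H
    refine ⟨le_of_eq (hmap H), ?_⟩
    have : (Subtype.val : H.map e.toMonoidHom → G₂) ⁻¹'
        ((H.map (e : G₁ →ₜ* G₂).toMonoidHom : Subgroup G₂) : Set G₂) = Set.univ := by
      rw [hmap]
      exact Set.eq_univ_of_forall fun x => x.2
    rw [this]
    exact isOpen_univ
  refine ⟨fun K₁ hK₁ => ⟨_, isMaximalCompactSubgroup_map e hK₁, hopen K₁⟩,
    fun K₁ H₁ hK₁ hH₁ hne hnt => ?_⟩
  have hinj : Function.Injective e.toMonoidHom := e.injective
  refine ⟨K₁.map e.toMonoidHom, H₁.map e.toMonoidHom, isMaximalCompactSubgroup_map e hK₁,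
    isMaximalCompactSubgroup_map e hH₁, ?_, ?_, ?_⟩
  · exact fun h => hne (Subgroup.map_injective hinj h)
  · rw [← Subgroup.map_inf _ _ e.toMonoidHom hinj]
    exact fun h => hnt ((Subgroup.map_eq_bot_iff_of_injective (K₁ ⊓ H₁) hinj).mp h)
  · rw [← Subgroup.map_inf _ _ e.toMonoidHom hinj]
    exact hopen _

end QuasiGeometric

end Literature.AnabelianGeometry.SemiGraphs
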